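import Summits.MatrixMultiplication.MatrixMultiplication.Theorems.FarEdgeDescentMomentDichotomy
import HarnessLib

/-!
# Far-edge descent, kernel XXXVI-A: the UNIVERSAL ANCHOR TAX — `θ_S` is the moment-level ceiling of every product-and-reanchor schedule

Route `FarEdgeDescent`, special leaf `FiniteSaturation` (stmt-MatrixMultiplication-23739): helper kernel,
THESES-FREE and def-free (decomp-mm lens 2 «structural dichotomy: special vs generic», gen 56).

THE QUESTION.  Kernels XXXII–XXXV certify `RateBeyond θ` for all `θ < θ_S = log(4/3)/log(3/2)` from the
isolated SQUARING tower and prove `θ_S` is the exact ceiling OF THAT TOWER (XXXIII).  The cost-free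
re-anchoring toolbox (Pan 1984 §16; Stothers 2010 Thm. 8) is larger: two isolated-anchor families
`⟨1,Q,1⟩ ⊕ legs` in normal form `r = Q + 2L` (`L = Σ km` over legs `⟨k,m,k⟩`) may be multiplied, the word
`anchor ⊗ anchor` deleted and the product re-anchored for free (`r'' = rr'`, `L'' = QL' + Q'L + LL'`), along
ANY schedule (a DAG: Fibonacci products `C_j ⊗ C_{j−1}`, skips, mixed bases, cubes …).  Does one beat `θ_S`?

THE ANSWER (moment level): NO, and squaring is extremal.  In the normalised moment coordinates of kernel XXXV
(`λ = L/r`, `ℓ = log r`, `m = M/r` leg mass, `n = N/r` anchor mass of the legs; a step is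
`λ'' = λ+λ'−3λλ'`, `ℓ'' = ℓ+ℓ'`, `m'' = (1−λ)m' + (1−λ')m`,
`n'' = (1−λ)n' + (1−λ')n + (1−2λ)λ' log Q + (1−2λ')λ log Q'`, `log Q = ℓ + log(1−2λ)`):
(A) `legMass_step`: `Φ = m/((3λ)^{1−κ} ℓ^κ)`, `κ = log₂(4/3)`, is MAX-NON-INCREASING under every step —
two-term Hölder (`holder_two`) plus the CHORD `(1−λ)^p ≤ 1 − 3λ/2` on `[0,1/3]` for the conjugate exponent
`p = 1/(1−κ) = log 2/log(3/2) = 1 + θ_S` (`chord`: convexity of `x^p` between `x = 2/3`, where `(2/3)^p = 1/2`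
EXACTLY (`twoThirds_rpow_conj`), and `x = 1`); equality iff equal log-ranks and `λ = λ' = 1/3` — the squaring
tower at its fixed point: `θ_S` is the equality case of Hölder.  (B) `legVolume_step`: `(M+N)/(L log r) ≥ u₀`
is hereditary (`log Q ≥ log r − log 3`).  (C) `schedule_invariant`: over any DAG of steps from thin bases the
base predicate is hereditary; hence the ANCHOR TAX (`anchorTax`, `anchorTax_certificate`): every moment
certificate `e(A) ≤ ι` (aspect `A = N/M`, intercept `ι = L log(r/L)/M`, XXXV-A `moment_certificate`) of ANY
schedule obeys `ι·(1+A)^{θ_S} ≥ c₀ = (log 3/3)(u₀λ₀)^{θ_S}/Φ₀^{1+θ_S} > 0` — the certificate cloud of the whole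
toolbox lies above the power curve of exponent `θ_S`; FAT certificates (bounded aspect, vanishing intercept
⟺ `FiniteSaturation`, XXXV-B) are unreachable from thin bases: THINNESS IS HEREDITARY under free re-anchoring.
The squaring tower of XXXV is a schedule (kernel XXXVI-B `FarEdgeDescentAnchorTaxTower`).
Scope: moment level; normal form `Q + 2L = r`, `3L ≤ r`.  Exact-readout ceilings of non-squaring schedules:
numerics only (memo NODE-g56 §3).  No tensors, no definitions.
References: Schönhage 1981 §5; Pan 1984 (LNCS 179) §16 Props. 16.2–16.5, §17 Thm. 17.1; Stothers 2010 Thm. 8;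
Knuth TAOCP 2 §4.6.4 Ex. 67(g),(h); Lotti–Romani 1983 Prop. 4.1; Hardy–Littlewood–Pólya, Inequalities,
Thms. 13 (Hölder), 37 (weighted AM–GM).
Tags: `FiniteSaturation` (h₁) NEC · WEAKER · method ceiling of the free-reanchoring toolbox (BC9-type theorem).
-/

set_option linter.dupNamespace false

noncomputable section

namespace Summit.MatrixMultiplication.MatrixMultiplication.Theorems.FarEdgeDescentAnchorTax

open Summit.MatrixMultiplication.MatrixMultiplication.Theorems.FarEdgeDescentImprovableRate
open Summit.MatrixMultiplication.MatrixMultiplication.Theorems.FarEdgeDescentMomentReadout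

/-! ## §1 Analysis: the conjugate exponent, the chord, the two-term Hölder inequality -/

/-- `1 − κ = log(3/2)/log 2` for `κ = log₂(4/3)`. [folklore] -/
theorem one_sub_kappa : 1 - Real.logb 2 ((4 : ℝ) / 3) = Real.log ((3 : ℝ) / 2) / Real.log 2 := by
  have h2 : Real.log (2 : ℝ) ≠ 0 := ne_of_gt (Real.log_pos (by norm_num))
  have h32 : Real.log ((3 : ℝ) / 2) = Real.log 2 - Real.log ((4 : ℝ) / 3) := by
    rw [← Real.log_div (by norm_num) (by norm_num)]
    norm_num
  rw [Real.logb, h32]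
  field_simp

/-- The conjugate exponent: `1/(1−κ) = log 2/log(3/2)` (`= 1.7095…`). [folklore] -/
theorem conj_exponent : 1 / (1 - Real.logb 2 ((4 : ℝ) / 3)) = Real.log 2 / Real.log ((3 : ℝ) / 2) := by
  rw [one_sub_kappa, one_div_div]

/-- **The magic identity** `(2/3)^{log 2/log(3/2)} = 1/2`: the squaring step at the fixed point `λ = 1/3`
(mass factor `2/3` per unit of doubled log-rank) is the equality case of the tax. [folklore] -/
theorem twoThirds_rpow_conj : ((2 : ℝ) / 3) ^ (Real.log 2 / Real.log ((3 : ℝ) / 2)) = 1 / 2 := by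
  rw [Real.rpow_def_of_pos (by norm_num)]
  have h23 : Real.log ((2 : ℝ) / 3) = -Real.log ((3 : ℝ) / 2) := by
    rw [← Real.log_inv]
    norm_num
  have hne : Real.log ((3 : ℝ) / 2) ≠ 0 := ne_of_gt (Real.log_pos (by norm_num))
  have e : Real.log ((2 : ℝ) / 3) * (Real.log 2 / Real.log ((3 : ℝ) / 2)) = -Real.log 2 := by
    rw [h23]
    field_simp
  rw [e, Real.exp_neg, Real.exp_log (by norm_num)]
  norm_num

/-- **The chord.**  If `p ≥ 1` and `(2/3)^p = 1/2` then `(1−x)^p ≤ 1 − (3/2)x` for `0 ≤ x ≤ 1/3`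
(convexity of `y ↦ y^p` between `y = 2/3` and `y = 1`). [cite: HardyLittlewoodPolya1952, Thm. 37] -/
theorem chord {p : ℝ} (hp : 1 ≤ p) (h23 : ((2 : ℝ) / 3) ^ p = 1 / 2) {x : ℝ} (hx0 : 0 ≤ x)
    (hx : x ≤ 1 / 3) : (1 - x) ^ p ≤ 1 - 3 / 2 * x := by
  have hc := (convexOn_rpow hp).2 (Set.mem_Ici.2 (by norm_num : (0 : ℝ) ≤ 2 / 3))
    (Set.mem_Ici.2 (zero_le_one : (0 : ℝ) ≤ 1)) (by linarith : 0 ≤ 3 * x)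
    (by linarith : 0 ≤ 1 - 3 * x) (by ring)
  simp only [smul_eq_mul] at hc
  have e1 : 3 * x * (2 / 3 : ℝ) + (1 - 3 * x) * 1 = 1 - x := by ring
  rw [e1, h23, Real.one_rpow] at hc
  linarith

/-- **Two-term Hölder inequality** (`0 < κ < 1`, all entries `≥ 0`):
`a^{1−κ}x^κ + b^{1−κ}y^κ ≤ (a+b)^{1−κ}(x+y)^κ` (weighted AM–GM applied to the two normalised terms).
[cite: HardyLittlewoodPolya1952, Thm. 13] -/
theorem holder_two {κ : ℝ} (hκ0 : 0 < κ) (hκ1 : κ < 1) {a b x y : ℝ} (ha : 0 ≤ a) (hb : 0 ≤ b)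
    (hx : 0 ≤ x) (hy : 0 ≤ y) :
    a ^ (1 - κ) * x ^ κ + b ^ (1 - κ) * y ^ κ ≤ (a + b) ^ (1 - κ) * (x + y) ^ κ := by
  have h1κ : (1 : ℝ) - κ ≠ 0 := by linarith
  rcases (add_nonneg ha hb).eq_or_lt with hA | hA
  · have ha0 : a = 0 := by linarith
    have hb0 : b = 0 := by linarith
    subst ha0
    subst hb0
    simp [Real.zero_rpow h1κ]
  rcases (add_nonneg hx hy).eq_or_lt with hX | hX
  · have hx0 : x = 0 := by linarith
    have hy0 : y = 0 := by linarith
    subst hx0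
    subst hy0
    simp [Real.zero_rpow hκ0.ne']
  have hD : 0 < (a + b) ^ (1 - κ) * (x + y) ^ κ :=
    mul_pos (Real.rpow_pos_of_pos hA _) (Real.rpow_pos_of_pos hX _)
  have key : ∀ {c z : ℝ}, 0 ≤ c → 0 ≤ z →
      c ^ (1 - κ) * z ^ κ / ((a + b) ^ (1 - κ) * (x + y) ^ κ) ≤
        (1 - κ) * (c / (a + b)) + κ * (z / (x + y)) := by
    intro c z hc hz
    have h := Real.geom_mean_le_arith_mean2_weighted (by linarith : 0 ≤ 1 - κ) hκ0.le
      (div_nonneg hc hA.le) (div_nonneg hz hX.le) (by ring)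
    rwa [Real.div_rpow hc hA.le, Real.div_rpow hz hX.le, div_mul_div_comm] at h
  have h1 := key ha hx
  have h2 := key hb hy
  have hsum : (a ^ (1 - κ) * x ^ κ + b ^ (1 - κ) * y ^ κ) / ((a + b) ^ (1 - κ) * (x + y) ^ κ) ≤ 1 := by
    rw [add_div]
    have e : (1 - κ) * (a / (a + b)) + κ * (x / (x + y)) +
        ((1 - κ) * (b / (a + b)) + κ * (y / (x + y))) = 1 := by
      field_simp
      ring
    linarith
  rwa [div_le_one hD] at hsum

/-- The anchor share of a normal-form configuration with `λ ≤ 1/3`: `log(1 − 2λ) ≥ −log 3`. [folklore] -/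
theorem log_anchorShare_ge {w : ℝ} (hw : w ≤ 1 / 3) : -Real.log 3 ≤ Real.log (1 - 2 * w) := by
  rw [← Real.log_inv]
  exact Real.log_le_log (by norm_num) (by rw [inv_eq_one_div]; linarith)

/-! ## §2 One product-and-reanchor step in normalised moment coordinates -/

/-- The leg fraction after a step, `λ'' = λ + λ' − 3λλ'`, stays in `[λ₀, 1/3]`
(`λ'' − λ = λ'(1−3λ) ≥ 0`, `1/3 − λ'' = (1−3λ)(1−3λ')/3 ≥ 0`). [cite: Pan1984, Prop. 16.5] -/
theorem lam_step {l₀ u v : ℝ} (hu0 : l₀ ≤ u) (hu : u ≤ 1 / 3) (hv0 : 0 ≤ v) (hv : v ≤ 1 / 3) :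
    l₀ ≤ u + v - 3 * u * v ∧ u + v - 3 * u * v ≤ 1 / 3 := by
  constructor
  · nlinarith [mul_nonneg hv0 (by linarith : (0 : ℝ) ≤ 1 - 3 * u)]
  · nlinarith [mul_nonneg (by linarith : (0 : ℝ) ≤ 1 - 3 * u) (by linarith : (0 : ℝ) ≤ 1 - 3 * v)]

/-- **(A) THE LEG-MASS TAX — one step.**  If `m ≤ Φ(3λ)^{1−κ}ℓ^κ` and `m' ≤ Φ(3λ')^{1−κ}ℓ'^κ`
(`λ, λ' ∈ [0,1/3]`, `κ ∈ (0,1)`, `p = 1/(1−κ)`, `(2/3)^p = 1/2`), then the product-and-reanchor step obeys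
`(1−λ)m' + (1−λ')m ≤ Φ(3λ'')^{1−κ}(ℓ+ℓ')^κ`: the potential `m/((3λ)^{1−κ}ℓ^κ)` is max-non-increasing.
Hölder (`holder_two`) after absorbing the weights, `(1−λ)c^{1−κ} = ((1−λ)^p c)^{1−κ}`, and the chord
`(1−λ)^p λ' + (1−λ')^p λ ≤ λ''`. [cite: Pan1984, Props. 16.4–16.5] [cite: HardyLittlewoodPolya1952, Thm. 13] -/
theorem legMass_step {κ p Φ u v m m' ℓ ℓ' : ℝ} (hκ0 : 0 < κ) (hκ1 : κ < 1) (hp : p = 1 / (1 - κ))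
    (h23 : ((2 : ℝ) / 3) ^ p = 1 / 2) (hΦ : 0 ≤ Φ) (hu0 : 0 ≤ u) (hu : u ≤ 1 / 3) (hv0 : 0 ≤ v)
    (hv : v ≤ 1 / 3) (hℓ : 0 ≤ ℓ) (hℓ' : 0 ≤ ℓ') (hm : m ≤ Φ * ((3 * u) ^ (1 - κ) * ℓ ^ κ))
    (hm' : m' ≤ Φ * ((3 * v) ^ (1 - κ) * ℓ' ^ κ)) :
    (1 - u) * m' + (1 - v) * m ≤ Φ * ((3 * (u + v - 3 * u * v)) ^ (1 - κ) * (ℓ + ℓ') ^ κ) := by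
  have h1κ : 0 < 1 - κ := by linarith
  have hp1 : 1 ≤ p := by
    rw [hp, le_div_iff₀ h1κ]
    linarith
  have hpk : p * (1 - κ) = 1 := by
    rw [hp]
    field_simp
  have absorb : ∀ {w c : ℝ}, 0 ≤ w → 0 ≤ c → w * c ^ (1 - κ) = (w ^ p * c) ^ (1 - κ) := by
    intro w c hw hc
    rw [Real.mul_rpow (Real.rpow_nonneg hw p) hc, ← Real.rpow_mul hw, hpk, Real.rpow_one]
  have hwu : 0 ≤ 1 - u := by linarith
  have hwv : 0 ≤ 1 - v := by linarith
  have cu := chord hp1 h23 hu0 hu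
  have cv := chord hp1 h23 hv0 hv
  have hau : 0 ≤ (1 - u) ^ p * (3 * v) := mul_nonneg (Real.rpow_nonneg hwu p) (by linarith)
  have hbv : 0 ≤ (1 - v) ^ p * (3 * u) := mul_nonneg (Real.rpow_nonneg hwv p) (by linarith)
  have t1 : (1 - u) * m' ≤ Φ * (((1 - u) ^ p * (3 * v)) ^ (1 - κ) * ℓ' ^ κ) := by
    calc (1 - u) * m' ≤ (1 - u) * (Φ * ((3 * v) ^ (1 - κ) * ℓ' ^ κ)) :=
          mul_le_mul_of_nonneg_left hm' hwu
      _ = Φ * (((1 - u) * (3 * v) ^ (1 - κ)) * ℓ' ^ κ) := by ring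
      _ = Φ * (((1 - u) ^ p * (3 * v)) ^ (1 - κ) * ℓ' ^ κ) := by rw [absorb hwu (by linarith)]
  have t2 : (1 - v) * m ≤ Φ * (((1 - v) ^ p * (3 * u)) ^ (1 - κ) * ℓ ^ κ) := by
    calc (1 - v) * m ≤ (1 - v) * (Φ * ((3 * u) ^ (1 - κ) * ℓ ^ κ)) :=
          mul_le_mul_of_nonneg_left hm hwv
      _ = Φ * (((1 - v) * (3 * u) ^ (1 - κ)) * ℓ ^ κ) := by ring
      _ = Φ * (((1 - v) ^ p * (3 * u)) ^ (1 - κ) * ℓ ^ κ) := by rw [absorb hwv (by linarith)]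
  have hH := holder_two hκ0 hκ1 hau hbv hℓ' hℓ
  have hab : (1 - u) ^ p * (3 * v) + (1 - v) ^ p * (3 * u) ≤ 3 * (u + v - 3 * u * v) := by
    nlinarith [mul_le_mul_of_nonneg_right cu (by linarith : (0 : ℝ) ≤ 3 * v),
      mul_le_mul_of_nonneg_right cv (by linarith : (0 : ℝ) ≤ 3 * u)]
  have hmono : ((1 - u) ^ p * (3 * v) + (1 - v) ^ p * (3 * u)) ^ (1 - κ) * (ℓ' + ℓ) ^ κ ≤
      (3 * (u + v - 3 * u * v)) ^ (1 - κ) * (ℓ + ℓ') ^ κ := by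
    rw [add_comm ℓ' ℓ]
    exact mul_le_mul_of_nonneg_right (Real.rpow_le_rpow (add_nonneg hau hbv) hab h1κ.le)
      (Real.rpow_nonneg (add_nonneg hℓ hℓ') κ)
  calc (1 - u) * m' + (1 - v) * m
      ≤ Φ * (((1 - u) ^ p * (3 * v)) ^ (1 - κ) * ℓ' ^ κ) +
          Φ * (((1 - v) ^ p * (3 * u)) ^ (1 - κ) * ℓ ^ κ) := add_le_add t1 t2
    _ = Φ * (((1 - u) ^ p * (3 * v)) ^ (1 - κ) * ℓ' ^ κ +
          ((1 - v) ^ p * (3 * u)) ^ (1 - κ) * ℓ ^ κ) := by ring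
    _ ≤ Φ * (((1 - u) ^ p * (3 * v) + (1 - v) ^ p * (3 * u)) ^ (1 - κ) * (ℓ' + ℓ) ^ κ) :=
        mul_le_mul_of_nonneg_left hH hΦ
    _ ≤ Φ * ((3 * (u + v - 3 * u * v)) ^ (1 - κ) * (ℓ + ℓ') ^ κ) :=
        mul_le_mul_of_nonneg_left hmono hΦ

/-- **(B) THE LEG-VOLUME FLOOR — one step.**  With `T = m + n` the total moment (log-volume) of the legs:
if `u₀λℓ ≤ m+n`, `u₀λ'ℓ' ≤ m'+n'` and `(1−u₀)ℓ, (1−u₀)ℓ' ≥ log 3` (`λ, λ' ∈ [0,1/3]`), then after the step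
`u₀λ''(ℓ+ℓ') ≤ m'' + n''` — because the injected anchor mass `(1−2λ)λ' log Q`, `log Q ≥ ℓ − log 3`,
pays for the re-anchoring loss. [cite: Pan1984, Prop. 16.5] [cite: Stothers2010, §1, Thm. 8] -/
theorem legVolume_step {u₀ u v m n m' n' ℓ ℓ' : ℝ} (hu0 : 0 ≤ u) (hu : u ≤ 1 / 3) (hv0 : 0 ≤ v)
    (hv : v ≤ 1 / 3) (hℓ : Real.log 3 ≤ (1 - u₀) * ℓ) (hℓ' : Real.log 3 ≤ (1 - u₀) * ℓ')
    (hT : u₀ * u * ℓ ≤ m + n) (hT' : u₀ * v * ℓ' ≤ m' + n') :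
    u₀ * (u + v - 3 * u * v) * (ℓ + ℓ') ≤
      ((1 - u) * m' + (1 - v) * m) +
        ((1 - u) * n' + (1 - v) * n + (1 - 2 * u) * v * (ℓ + Real.log (1 - 2 * u)) +
          (1 - 2 * v) * u * (ℓ' + Real.log (1 - 2 * v))) := by
  have hlu := log_anchorShare_ge hu
  have hlv := log_anchorShare_ge hv
  have key : ((1 - u) * m' + (1 - v) * m) +
        ((1 - u) * n' + (1 - v) * n + (1 - 2 * u) * v * (ℓ + Real.log (1 - 2 * u)) +
          (1 - 2 * v) * u * (ℓ' + Real.log (1 - 2 * v))) - u₀ * (u + v - 3 * u * v) * (ℓ + ℓ') =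
      (1 - u) * ((m' + n') - u₀ * v * ℓ') + (1 - v) * ((m + n) - u₀ * u * ℓ) +
        (1 - 2 * u) * v * ((ℓ + Real.log (1 - 2 * u)) - u₀ * ℓ) +
        (1 - 2 * v) * u * ((ℓ' + Real.log (1 - 2 * v)) - u₀ * ℓ') := by ring
  have p1 : 0 ≤ (1 - u) * ((m' + n') - u₀ * v * ℓ') := mul_nonneg (by linarith) (by linarith)
  have p2 : 0 ≤ (1 - v) * ((m + n) - u₀ * u * ℓ) := mul_nonneg (by linarith) (by linarith)
  have p3 : 0 ≤ (1 - 2 * u) * v * ((ℓ + Real.log (1 - 2 * u)) - u₀ * ℓ) :=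
    mul_nonneg (mul_nonneg (by linarith) hv0) (by linarith)
  have p4 : 0 ≤ (1 - 2 * v) * u * ((ℓ' + Real.log (1 - 2 * v)) - u₀ * ℓ') :=
    mul_nonneg (mul_nonneg (by linarith) hu0) (by linarith)
  linarith [key, p1, p2, p3, p4]

/-! ## §3 Schedules: the base predicate is hereditary over every DAG of steps -/

/-- **SCHEDULE INVARIANT.**  Let `(λ_j, ℓ_j, m_j, n_j)_{j∈ℕ}` be any schedule: every index is EITHER a base
satisfying the thin-base predicate `λ₀ ≤ λ ≤ 1/3`, `ℓ ≥ ℓ₀`, `m > 0`, `n ≥ 0`, `m ≤ Φ(3λ)^{1−κ}ℓ^κ`,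
`u₀λℓ ≤ m+n`, OR the product-and-reanchor of two EARLIER indices (any DAG: squaring, Fibonacci, skips, mixed
bases …).  If `(1−u₀)ℓ₀ ≥ log 3` then EVERY index satisfies the base predicate. [cite: Pan1984, Props. 16.2–16.5]
[cite: Stothers2010, §1, Thm. 8] -/
theorem schedule_invariant {κ p Φ u₀ l₀ ℓ₀ : ℝ} (lam ℓ m n : ℕ → ℝ) (hκ0 : 0 < κ) (hκ1 : κ < 1)
    (hp : p = 1 / (1 - κ)) (h23 : ((2 : ℝ) / 3) ^ p = 1 / 2) (hΦ : 0 ≤ Φ) (hu₀ : 0 ≤ u₀)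
    (hl₀ : 0 < l₀) (hℓ₀0 : 0 < ℓ₀) (hℓ₀ : Real.log 3 ≤ (1 - u₀) * ℓ₀)
    (H : ∀ j, (l₀ ≤ lam j ∧ lam j ≤ 1 / 3 ∧ ℓ₀ ≤ ℓ j ∧ 0 < m j ∧ 0 ≤ n j ∧
        m j ≤ Φ * ((3 * lam j) ^ (1 - κ) * ℓ j ^ κ) ∧ u₀ * lam j * ℓ j ≤ m j + n j) ∨
      (∃ a, a < j ∧ ∃ b, b < j ∧ lam j = lam a + lam b - 3 * lam a * lam b ∧ ℓ j = ℓ a + ℓ b ∧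
        m j = (1 - lam a) * m b + (1 - lam b) * m a ∧
        n j = (1 - lam a) * n b + (1 - lam b) * n a +
          (1 - 2 * lam a) * lam b * (ℓ a + Real.log (1 - 2 * lam a)) +
          (1 - 2 * lam b) * lam a * (ℓ b + Real.log (1 - 2 * lam b)))) :
    ∀ j, l₀ ≤ lam j ∧ lam j ≤ 1 / 3 ∧ ℓ₀ ≤ ℓ j ∧ 0 < m j ∧ 0 ≤ n j ∧
        m j ≤ Φ * ((3 * lam j) ^ (1 - κ) * ℓ j ^ κ) ∧ u₀ * lam j * ℓ j ≤ m j + n j := by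
  have h1u : 0 ≤ 1 - u₀ := by
    rcases le_or_gt 0 (1 - u₀) with h | h
    · exact h
    · nlinarith [Real.log_pos (by norm_num : (1 : ℝ) < 3), mul_neg_of_neg_of_pos h hℓ₀0]
  have hℓ₀3 : Real.log 3 ≤ ℓ₀ := by nlinarith
  intro j
  induction j using Nat.strong_induction_on with
  | _ j ih => ?_
  rcases H j with hb | ⟨a, ha, b, hb, e1, e2, e3, e4⟩
  · exact hb
  obtain ⟨a0, a1, a2, a3, a4, a5, a6⟩ := ih a ha
  obtain ⟨b0, b1, b2, b3, b4, b5, b6⟩ := ih b hb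
  have a0' : 0 ≤ lam a := le_trans hl₀.le a0
  have b0' : 0 ≤ lam b := le_trans hl₀.le b0
  have hℓa : Real.log 3 ≤ (1 - u₀) * ℓ a := le_trans hℓ₀ (mul_le_mul_of_nonneg_left a2 h1u)
  have hℓb : Real.log 3 ≤ (1 - u₀) * ℓ b := le_trans hℓ₀ (mul_le_mul_of_nonneg_left b2 h1u)
  have hQa : 0 ≤ ℓ a + Real.log (1 - 2 * lam a) := by linarith [log_anchorShare_ge a1]
  have hQb : 0 ≤ ℓ b + Real.log (1 - 2 * lam b) := by linarith [log_anchorShare_ge b1]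
  refine ⟨?_, ?_, ?_, ?_, ?_, ?_, ?_⟩
  · rw [e1]; exact (lam_step a0 a1 b0' b1).1
  · rw [e1]; exact (lam_step a0 a1 b0' b1).2
  · rw [e2]; linarith
  · rw [e3]; nlinarith [mul_pos (by linarith : 0 < 1 - lam a) b3, mul_pos (by linarith : 0 < 1 - lam b) a3]
  · rw [e4]
    have q1 : 0 ≤ (1 - lam a) * n b := mul_nonneg (by linarith) b4
    have q2 : 0 ≤ (1 - lam b) * n a := mul_nonneg (by linarith) a4
    have q3 : 0 ≤ (1 - 2 * lam a) * lam b * (ℓ a + Real.log (1 - 2 * lam a)) :=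
      mul_nonneg (mul_nonneg (by linarith) b0') hQa
    have q4 : 0 ≤ (1 - 2 * lam b) * lam a * (ℓ b + Real.log (1 - 2 * lam b)) :=
      mul_nonneg (mul_nonneg (by linarith) a0') hQb
    linarith
  · rw [e3, e1, e2]
    exact legMass_step hκ0 hκ1 hp h23 hΦ a0' a1 b0' b1 (by linarith) (by linarith) a5 b5
  · rw [e1, e2, e3, e4]
    exact legVolume_step a0' a1 b0' b1 hℓa hℓb a6 b6

/-! ## §4 The anchor tax: every moment certificate of every schedule lies above the power curve of exponent `θ_S` -/

/-- **THE UNIVERSAL ANCHOR TAX** (division-free form).  Along any schedule as in `schedule_invariant`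
(`Φ, u₀, λ₀ > 0`), with `θ = κp = κ/(1−κ)`:  `c₀ · m_j^p ≤ λ_j log(1/λ_j) · (m_j + n_j)^θ` for every `j`,
`c₀ = (log 3/3)(u₀λ₀)^θ/Φ^p`.  (`m^p ≤ Φ^p·3λ·ℓ^θ` by (A), `(m+n)^θ ≥ (u₀λ₀)^θ ℓ^θ` by (B), `log(1/λ) ≥ log 3`.)
For `κ = log₂(4/3)`: `p = 1 + θ_S`, `θ = θ_S = log(4/3)/log(3/2)`. [cite: Pan1984, Thm. 17.1]
[cite: Schonhage1981, §5] -/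
theorem anchorTax {κ p Φ u₀ l₀ ℓ₀ : ℝ} (lam ℓ m n : ℕ → ℝ) (hκ0 : 0 < κ) (hκ1 : κ < 1)
    (hp : p = 1 / (1 - κ)) (h23 : ((2 : ℝ) / 3) ^ p = 1 / 2) (hΦ : 0 < Φ) (hu₀ : 0 < u₀)
    (hl₀ : 0 < l₀) (hℓ₀0 : 0 < ℓ₀) (hℓ₀ : Real.log 3 ≤ (1 - u₀) * ℓ₀)
    (H : ∀ j, (l₀ ≤ lam j ∧ lam j ≤ 1 / 3 ∧ ℓ₀ ≤ ℓ j ∧ 0 < m j ∧ 0 ≤ n j ∧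
        m j ≤ Φ * ((3 * lam j) ^ (1 - κ) * ℓ j ^ κ) ∧ u₀ * lam j * ℓ j ≤ m j + n j) ∨
      (∃ a, a < j ∧ ∃ b, b < j ∧ lam j = lam a + lam b - 3 * lam a * lam b ∧ ℓ j = ℓ a + ℓ b ∧
        m j = (1 - lam a) * m b + (1 - lam b) * m a ∧
        n j = (1 - lam a) * n b + (1 - lam b) * n a +
          (1 - 2 * lam a) * lam b * (ℓ a + Real.log (1 - 2 * lam a)) +
          (1 - 2 * lam b) * lam a * (ℓ b + Real.log (1 - 2 * lam b)))) (j : ℕ) :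
    Real.log 3 / 3 * (u₀ * l₀) ^ (κ * p) / Φ ^ p * m j ^ p ≤
      lam j * Real.log (1 / lam j) * (m j + n j) ^ (κ * p) := by
  obtain ⟨h0, h1, h2, h3, -, h5, h6⟩ :=
    schedule_invariant lam ℓ m n hκ0 hκ1 hp h23 hΦ.le hu₀.le hl₀ hℓ₀0 hℓ₀ H j
  have h1κ : 0 < 1 - κ := by linarith
  have hp0 : 0 < p := by rw [hp]; positivity
  have hθ : 0 ≤ κ * p := by positivity
  have hpk : (1 - κ) * p = 1 := by rw [hp]; field_simp
  have hlam : 0 < lam j := lt_of_lt_of_le hl₀ h0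
  have hℓ : 0 < ℓ j := lt_of_lt_of_le hℓ₀0 h2
  have hΦp : 0 < Φ ^ p := Real.rpow_pos_of_pos hΦ p
  have mp : m j ^ p ≤ Φ ^ p * (3 * lam j) * ℓ j ^ (κ * p) := by
    calc m j ^ p ≤ (Φ * ((3 * lam j) ^ (1 - κ) * ℓ j ^ κ)) ^ p := Real.rpow_le_rpow h3.le h5 hp0.le
      _ = Φ ^ p * (((3 * lam j) ^ (1 - κ)) ^ p * (ℓ j ^ κ) ^ p) := by
          rw [Real.mul_rpow hΦ.le (by positivity), Real.mul_rpow (by positivity) (by positivity)]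
      _ = Φ ^ p * (3 * lam j) * ℓ j ^ (κ * p) := by
          rw [← Real.rpow_mul (by positivity), hpk, Real.rpow_one, ← Real.rpow_mul hℓ.le]
          ring
  have Tθ : (u₀ * l₀) ^ (κ * p) * ℓ j ^ (κ * p) ≤ (m j + n j) ^ (κ * p) := by
    calc (u₀ * l₀) ^ (κ * p) * ℓ j ^ (κ * p) = (u₀ * l₀ * ℓ j) ^ (κ * p) := by
          rw [← Real.mul_rpow (by positivity) hℓ.le]
      _ ≤ (u₀ * lam j * ℓ j) ^ (κ * p) :=
          Real.rpow_le_rpow (by positivity) (by nlinarith [mul_pos hu₀ hℓ]) hθ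
      _ ≤ (m j + n j) ^ (κ * p) := Real.rpow_le_rpow (by positivity) h6 hθ
  have hlog3 : Real.log 3 ≤ Real.log (1 / lam j) :=
    Real.log_le_log (by norm_num) (by rw [le_div_iff₀ hlam]; linarith)
  have hl3 : 0 < Real.log 3 := Real.log_pos (by norm_num)
  calc Real.log 3 / 3 * (u₀ * l₀) ^ (κ * p) / Φ ^ p * m j ^ p
      ≤ Real.log 3 / 3 * (u₀ * l₀) ^ (κ * p) / Φ ^ p * (Φ ^ p * (3 * lam j) * ℓ j ^ (κ * p)) :=
        mul_le_mul_of_nonneg_left mp (by positivity)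
    _ = lam j * Real.log 3 * ((u₀ * l₀) ^ (κ * p) * ℓ j ^ (κ * p)) := by
        field_simp
    _ ≤ lam j * Real.log (1 / lam j) * (m j + n j) ^ (κ * p) :=
        mul_le_mul (mul_le_mul_of_nonneg_left hlog3 hlam.le) Tθ (by positivity)
          (mul_nonneg hlam.le (le_trans hl3.le hlog3))

/-- **THE UNIVERSAL ANCHOR TAX** (certificate form).  In the certificate plane of kernel XXXV-A — aspect
`A = n/m = N/M`, intercept `ι = λ log(1/λ)/m = L log(r/L)/M`, the line certificate meaning `e(A) ≤ ι` — every
certificate of every schedule satisfies `ι · (1 + A)^θ ≥ c₀ > 0`: the whole certificate cloud of the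
free-reanchoring toolbox lies on or above the power curve `ι = c₀(1+A)^{−θ}`, `θ = κ/(1−κ)` (`= θ_S` for
`κ = log₂(4/3)`).  No schedule certifies, at moment level, a rate beyond `θ_S`; FAT certificates are unreachable.
[cite: Pan1984, Thm. 17.1] [cite: LottiRomani1983, Prop. 4.1] -/
theorem anchorTax_certificate {κ p Φ u₀ l₀ ℓ₀ : ℝ} (lam ℓ m n : ℕ → ℝ) (hκ0 : 0 < κ) (hκ1 : κ < 1)
    (hp : p = 1 / (1 - κ)) (h23 : ((2 : ℝ) / 3) ^ p = 1 / 2) (hΦ : 0 < Φ) (hu₀ : 0 < u₀)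
    (hl₀ : 0 < l₀) (hℓ₀0 : 0 < ℓ₀) (hℓ₀ : Real.log 3 ≤ (1 - u₀) * ℓ₀)
    (H : ∀ j, (l₀ ≤ lam j ∧ lam j ≤ 1 / 3 ∧ ℓ₀ ≤ ℓ j ∧ 0 < m j ∧ 0 ≤ n j ∧
        m j ≤ Φ * ((3 * lam j) ^ (1 - κ) * ℓ j ^ κ) ∧ u₀ * lam j * ℓ j ≤ m j + n j) ∨
      (∃ a, a < j ∧ ∃ b, b < j ∧ lam j = lam a + lam b - 3 * lam a * lam b ∧ ℓ j = ℓ a + ℓ b ∧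
        m j = (1 - lam a) * m b + (1 - lam b) * m a ∧
        n j = (1 - lam a) * n b + (1 - lam b) * n a +
          (1 - 2 * lam a) * lam b * (ℓ a + Real.log (1 - 2 * lam a)) +
          (1 - 2 * lam b) * lam a * (ℓ b + Real.log (1 - 2 * lam b)))) (j : ℕ) :
    Real.log 3 / 3 * (u₀ * l₀) ^ (κ * p) / Φ ^ p ≤
      lam j * Real.log (1 / lam j) / m j * (1 + n j / m j) ^ (κ * p) := by
  have htax := anchorTax lam ℓ m n hκ0 hκ1 hp h23 hΦ hu₀ hl₀ hℓ₀0 hℓ₀ H j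
  obtain ⟨-, -, -, h3, h4, -, -⟩ :=
    schedule_invariant lam ℓ m n hκ0 hκ1 hp h23 hΦ.le hu₀.le hl₀ hℓ₀0 hℓ₀ H j
  have h1κ : 0 < 1 - κ := by linarith
  have hp' : p = κ * p + 1 := by rw [hp]; field_simp; ring
  have hmθ : 0 < m j ^ (κ * p) := Real.rpow_pos_of_pos h3 _
  have e1 : m j ^ p = m j ^ (κ * p) * m j := by rw [hp', Real.rpow_add_one h3.ne', ← hp']
  have e2 : lam j * Real.log (1 / lam j) / m j * (1 + n j / m j) ^ (κ * p) =
      lam j * Real.log (1 / lam j) * (m j + n j) ^ (κ * p) / (m j ^ (κ * p) * m j) := by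
    rw [show 1 + n j / m j = (m j + n j) / m j by field_simp, Real.div_rpow (by linarith) h3.le]
    field_simp
  rw [e2, le_div_iff₀ (mul_pos hmθ h3)]
  calc Real.log 3 / 3 * (u₀ * l₀) ^ (κ * p) / Φ ^ p * (m j ^ (κ * p) * m j)
      = Real.log 3 / 3 * (u₀ * l₀) ^ (κ * p) / Φ ^ p * m j ^ p := by rw [e1]
    _ ≤ lam j * Real.log (1 / lam j) * (m j + n j) ^ (κ * p) := htax

end Summit.MatrixMultiplication.MatrixMultiplication.Theorems.FarEdgeDescentAnchorTax

end
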